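import Summits.BirchSwinnertonDyer.Rank1Residual.X12.InertBadOddPrimeStepL
import Literature.NumberTheory.EllipticCurves.AgasheRibetStein2006.ManinConstantX12Three
import Literature.NumberTheory.EllipticCurves.CuspFormLFunctionLevelConductorProofs
import HarnessLib

/-!
# X12, `p = 3` inert-bad window: route T-KR at `p = 3` PER PAIR with the Manin datum discharged by
# Cremona's table (cell `b2b-bsdres`, unit `b2b-bsdres-x1b`, gen 12)

HONEST FRAMING (cell `b2b-bsdres`, run/shared/lean/b2b/bsd-rank1-residual/, verbatim in every
file): the goal of the cell is to DELETE the COMBINATION-SHAPED residual classes of the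
Birch–Swinnerton-Dyer formula for ALL analytic-rank `≤ 1` elliptic curves over `ℚ` — "full BSD
formula for every rank `≤ 1` curve in class `C`" assembled STRICTLY from published theorems — so
that the rank-`≤ 1` remainder becomes exactly the CONSTRUCTION-SHAPED classes, which are TYPED
(missing-input `Prop`s), NOT attempted. This is not "finishing BSD". Unit `b2b-bsdres-x1b`
(CLASS-OWNERS row "X12 inert-bad core", prover owner), generation 12; research route, no claim
beyond the stated class; X12 REMAINS CONSTRUCTION-SHAPED; nothing is booked (the lane books, the
referee rules).
Theorems only; no definition, no new named fact. Sibling of gen 9's `X12/InertCoreRecords.lean`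
(the `p ≥ 5` core over `cremonaCurveOneX12Core`).

For the 21 classes of `cremonaCurveOneX12Three` (Agashe–Ribet–Stein 2006 appendix Thm. 5.2 on the
`p = 3` inert-bad window: `288a1, 441d1, 576h1, 2304a1/b1/p1, 7200a1/bd1/be1/bg1/q1, 11025y1,
14112bj1/bk1/bn1/x1, 14400db1/dc1/dd1/de1/dn1`, p222044) the Manin binder `3 ∤ c(D)` of gen 12's
`X12/InertBadOddPrime.lean` is Cremona's PUBLISHED table (`h52`: curve `1` optimal; `h26`: `c = 1`
for `N ≤ 130000`), and `3 ∣ N` is read off the list; what remains per pair is `ClassX12 W 3` (CM —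
decidable from `j` — and `r_an = 1`, the lane's certificate), `¬ CMRamified W 3` (`3 ∤ d_K`,
decidable from `j`: here `j ∈ {1728, −3375}`), the Tamagawa datum `3 ∤ ∏c_ℓ` and the exact
`#Ш_an` with `ord_3 = 0` — both certified in TWO engines on all 21 (Cremona `allbsd` ‖ PARI kit
j100150; `HOME/b2b-bsdres-x1b/gen12/census3/`).

* `missingUpperBoundAt_three_of_mem_cremonaCurveOneX12Three` — the UPPER half of `BSD(E,3)` at a
  listed pair with NO Manin binder left.
* `bsdp_three_of_mem_cremonaCurveOneX12Three_of_shaAn_unit` — route T-KR@3: `+ ord_3 #Ш_an = 0 ⟹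
  BSD(E,3)`.
* `bsdp_three_iff_missingLowerBoundAt_of_mem_cremonaCurveOneX12Three` — at a listed pair,
  `BSD(E,3) ⟺ MissingLowerBoundAt W 3` (the typed residue, per pair).

References: [AgasheRibetStein2006] Thm. 2.6, appendix Thm. 5.2; [MatarNekovar2019] Thm. 0.3 /
§0.11; [Miller2011LMS] Def. 1.1; [Cremona1997] Table 1.
-/

noncomputable section

open scoped Classical NumberField

open WeierstrassCurve NumberField Literature.NumberTheory.EllipticCurves
  Literature.NumberTheory.EllipticCurves.ModularForms
  Literature.NumberTheory.EllipticCurves.Rank1Residual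
  Literature.NumberTheory.EllipticCurves.Rank1Residual.Typed
  Literature.NumberTheory.EllipticCurves.AgasheRibetStein2006
  Literature.NumberTheory.Automorphic
  IsDedekindDomain

namespace Summit.BirchSwinnertonDyer.Rank1Residual.X12

/-! The PUBLISHED named facts of the tree used throughout (as in `X12/InertBadOddPrime.lean`) plus
Cremona's two sentences (`h26`, `h52`). -/
variable
  (hGZ : ∀ (N : ℕ) [NeZero N] (W : WeierstrassCurve ℚ) (K : Type) [Field K] [NumberField K],
    gross_zagier N W K)
  (hKo : ∀ (N : ℕ) [NeZero N] (W : WeierstrassCurve ℚ) (K : Type) [Field K] [NumberField K],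
    kolyvagin N W K)
  (hMN : ∀ (N : ℕ) [NeZero N] (W : WeierstrassCurve ℚ) (K : Type) [Field K] [NumberField K],
    MatarNekovar2019.thm03_padicValNat_card_sha_le_of_irreducible N W K)
  (hGZK : rank_eq_analyticRank_of_analyticRank_le_one) (hmod : hasEntireLFunction_rat)
  (hnf : exists_isNewformOf) (hFH : friedbergHoffstein_exists_heegnerField_split_twist_ne_zero)
  (hCM8 : bsdTriple_of_hasCM_of_L_one_ne_zero)
  (h26 : cremona_abs_maninConstant_eq_one_of_level_le) (h52 : cremona_optimal_curveOne_x12Three)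

include hGZ hKo hMN hGZK hmod hnf hFH hCM8 h26 h52

/-- **The UPPER half of `BSD(E,3)` at every listed `p = 3` window pair, with NO Manin binder left**:
for the minimal model `W` of the curve numbered `1` of one of the 21 classes of
`cremonaCurveOneX12Three` (`(W, N)` in the list), `ClassX12 W 3`, `3 ∤ d_K` and `3 ∤ ∏c_ℓ(E)` give
`MissingUpperBoundAt W 3`. The Manin datum is Cremona's table (Thm. 5.2: curve `1` optimal; Thm.
2.6: `c = 1`), `3 ∣ N = N_E` is read off the list (the level of an optimal datum is the conductor,
`IsNewformOf.level_eq_conductorNorm_of_exists_isNewformOf`). [cite: AgasheRibetStein2006, Thm. 2.6 and appendix Thm. 5.2]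
[cite: MatarNekovar2019, Thm. 0.3 and §0.11] [cite: Miller2011LMS, Def. 1.1] -/
theorem missingUpperBoundAt_three_of_mem_cremonaCurveOneX12Three
    (W : WeierstrassCurve ℚ) [W.IsElliptic] [W.IsGloballyMinimal] (N : ℕ) [NeZero N]
    (hmem : (W, N) ∈ cremonaCurveOneX12Three)
    (hX : ClassX12 W 3) (hnr : ¬ CMRamified W 3) (htam : ¬ 3 ∣ W.tamagawaProduct) :
    MissingUpperBoundAt W 3 := by
  obtain ⟨D, -, -, hc⟩ := exists_optimal_abs_maninConstant_eq_one_of_mem_x12Three h26 h52 W N hmem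
  have h3N : 3 ∣ N := three_dvd_level_of_mem_cremonaCurveOneX12Three hmem
  have hN : N = W.conductorNorm ℤ :=
    IsNewformOf.level_eq_conductorNorm_of_exists_isNewformOf hnf D.isNewformOf
  subst hN
  have hbad : ¬ Good W 3 := (W.dvd_conductorNorm_iff_not_hasGoodReductionAtPrime 3).mp h3N
  exact missingUpperBoundAt_three_of_classX12_of_bad hGZ hKo hMN hGZK hmod hnf hFH hCM8 W hX hbad hnr
    D (hc 3 Nat.prime_three) htam

/-- **Route T-KR at `p = 3`, every listed window pair**: `ClassX12 W 3` (CM, `r_an = 1`),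
`3 ∤ d_K`, `3 ∤ ∏c_ℓ(E)` and a CERTIFIED `#Ш(E)_an = q` with `ord_3 q = 0` give `BSD(E,3)` — the
Manin datum being Cremona's published table. No Heegner index, no descent. PER PAIR; nothing
booked; X12 stays CONSTRUCTION-SHAPED. [cite: AgasheRibetStein2006, Thm. 2.6 and appendix Thm. 5.2]
[cite: MatarNekovar2019, Thm. 0.3 and §0.11] [cite: Miller2011LMS, §1 and Def. 1.1] -/
theorem bsdp_three_of_mem_cremonaCurveOneX12Three_of_shaAn_unit
    (W : WeierstrassCurve ℚ) [W.IsElliptic] [W.IsGloballyMinimal] (N : ℕ) [NeZero N]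
    (hmem : (W, N) ∈ cremonaCurveOneX12Three)
    (hX : ClassX12 W 3) (hnr : ¬ CMRamified W 3) (htam : ¬ 3 ∣ W.tamagawaProduct)
    {q : ℚ} (hq : shaAn W = (q : ℂ)) (hv : padicValRat 3 q = 0) : BSDp W 3 := by
  obtain ⟨D, -, -, hc⟩ := exists_optimal_abs_maninConstant_eq_one_of_mem_x12Three h26 h52 W N hmem
  have h3N : 3 ∣ N := three_dvd_level_of_mem_cremonaCurveOneX12Three hmem
  have hN : N = W.conductorNorm ℤ :=
    IsNewformOf.level_eq_conductorNorm_of_exists_isNewformOf hnf D.isNewformOf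
  subst hN
  have hbad : ¬ Good W 3 := (W.dvd_conductorNorm_iff_not_hasGoodReductionAtPrime 3).mp h3N
  exact bsdp_three_of_classX12_of_bad_of_shaAn_unit hGZ hKo hMN hGZK hmod hnf hFH hCM8 W hX hbad hnr D
    (hc 3 Nat.prime_three) htam hq hv

/-- **At every listed `p = 3` window pair, `BSD(E,3) ⟺ MissingLowerBoundAt W 3`** (the typed
residue, per pair; Manin by Cremona's table, `3 ∤ ∏c_ℓ` a datum): "⇐" is gen 12's upper half,
"⇒" is bookkeeping (`Ш` finite by GZK in analytic rank one). Companion of gen 9's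
`bsdp_iff_missingLowerBoundAt_of_mem_cremonaCurveOneX12Core`. [cite: AgasheRibetStein2006, Thm. 2.6 and appendix Thm. 5.2]
[cite: MatarNekovar2019, Thm. 0.3 and §0.11] [cite: Miller2011LMS, §1 and Def. 1.1] -/
theorem bsdp_three_iff_missingLowerBoundAt_of_mem_cremonaCurveOneX12Three
    (W : WeierstrassCurve ℚ) [W.IsElliptic] [W.IsGloballyMinimal] (N : ℕ) [NeZero N]
    (hmem : (W, N) ∈ cremonaCurveOneX12Three)
    (hX : ClassX12 W 3) (hnr : ¬ CMRamified W 3) (htam : ¬ 3 ∣ W.tamagawaProduct) :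
    BSDp W 3 ↔ MissingLowerBoundAt W 3 := by
  obtain ⟨D, -, -, hc⟩ := exists_optimal_abs_maninConstant_eq_one_of_mem_x12Three h26 h52 W N hmem
  have h3N : 3 ∣ N := three_dvd_level_of_mem_cremonaCurveOneX12Three hmem
  have hN : N = W.conductorNorm ℤ :=
    IsNewformOf.level_eq_conductorNorm_of_exists_isNewformOf hnf D.isNewformOf
  subst hN
  have hbad : ¬ Good W 3 := (W.dvd_conductorNorm_iff_not_hasGoodReductionAtPrime 3).mp h3N
  refine ⟨fun hb ↦ ?_, fun hlow ↦ ?_⟩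
  · haveI : Finite W.sha := (hGZK W (by rw [hX.2.1])).2
    exact (lower_and_upper_of_missingPPartAt W 3 (missingPPartAt_of_bsdp W 3 hb)).1
  · exact bsdp_three_of_classX12_of_bad_of_lower hGZ hKo hMN hGZK hmod hnf hFH hCM8 W hX hbad hnr D
      (hc 3 Nat.prime_three) htam hlow

end Summit.BirchSwinnertonDyer.Rank1Residual.X12

end
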